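import Mathlib
import Summits.Ventures.PercRepro2.Defs
import Summits.Ventures.PercRepro2.Independence
import Summits.Ventures.PercRepro2.Harris
import Summits.Ventures.PercRepro2.Graph
import Summits.Ventures.PercRepro2.Exploration
import Summits.Ventures.PercRepro2.Events
import Summits.Ventures.PercRepro2.CutVertexDefs
import Summits.Ventures.PercRepro2.CDCutVertex

/-!
# Row 2′CD transfers across a cut vertex that separates the mark `o` from the roots and `a₃`
(blind cell PercRepro2, mine-a g34; MINE-A.md §89)

Let `z` be a cut vertex (`CutV.IsCut ends z VA VB EA EB`) with `a₁, a₂, a₃ ∈ VA ∪ {z}` and `o ∈ VB`,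
and let the family `𝓔` read only the near side (`S ∈ 𝓔 ↔ S ∩ (VA ∪ {z}) ∈ 𝓔`).  Then row 2′CD for the
mark `o` FOLLOWS from row 2′CD for the mark `z` (same roots, same `a₃`, same `𝓔`, same weights):

  `(CD)(z)  ⟹  (CD)(o)`   (`cd_of_cut_o`; no up-set hypothesis is needed for the transfer).

Proof (the product law).  Every `a₁–o` or `a₂–o` path passes through `z`, so `{a_i ↔ o} = {a_i ↔ z} ∩ H`
with `H = {z ↔ o inside B}` (`CDCutVertex.conn_iff_across_or_cut`); `Q`, `U`, `e`, `N` and the `z`-events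
are read on the near side (`CutV.connEvent_eq_sideEvent`, `CutV.cluster_inter_eq`), `H` on the far side,
and the two sides are independent (`prob_inter_eq_mul_of_dependsOn`).  Hence the three `o`-probabilities
of the row are the `z`-probabilities times `ρ = P(H)`, the other five coincide, and the row for `o` is
`ρ ≥ 0` times the row for `z`.  Combined with the class theorems (`CDCylinder`, `CDCutVertex`, `CDPocket`)
this puts `o` anywhere beyond a cut vertex of a proved placement.  No definition; one seat.
-/

namespace Summit.Ventures.PercRepro2

namespace CDCutO

section Main

variable {V : Type*} {E : Type*} [Fintype E] [DecidableEq E]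
  {R : Type*} [Field R] [LinearOrder R] [IsStrictOrderedRing R]

variable {ends : E → Sym2 V} {z : V} {VA VB : Set V} {EA EB : Set E} [DecidablePred (· ∈ EA)]
  [DecidablePred (· ∈ EB)]

omit [Fintype E] [DecidableEq E] in
/-- Across the cut, for `u ∈ VA ∪ {z}` and `o ∈ VB`: `{u ↔ o} = {u ↔ z} ∩ {z ↔ o inside B}`. -/
lemma connEvent_o_eq (h : CutV.IsCut ends z VA VB EA EB) {u o : V} (hu : u ∈ VA ∪ {z})
    (ho : o ∈ VB) :
    connEvent ends u o = connEvent ends u z ∩ CutV.sideEvent EB (connEvent ends z o) := by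
  ext ω
  simp only [Set.mem_inter_iff, mem_connEvent, CutV.mem_sideEvent]
  rw [CDCutVertex.conn_iff_across_or_cut h hu (Or.inl ho),
    CutV.conn_iff_restrict h (ω := ω) hu (Or.inr rfl)]

omit [Fintype E] [DecidableEq E] [DecidablePred (· ∈ EB)] in
/-- A connection event between two near-side vertices is determined by the near-side edges. -/
lemma dependsOn_connEvent_near (h : CutV.IsCut ends z VA VB EA EB) {u v : V} (hu : u ∈ VA ∪ {z})
    (hv : v ∈ VA ∪ {z}) : DependsOn (· ∈ connEvent ends u v) EA := by
  rw [CutV.connEvent_eq_sideEvent h hu hv]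
  exact CutV.dependsOn_sideEvent EA _

omit [Fintype E] [DecidableEq E] [DecidablePred (· ∈ EB)] in
/-- If `𝓔` reads only the near side, `{C(a₁) ∈ 𝓔}` is determined by the near-side edges. -/
lemma dependsOn_clusterInEvent_near (h : CutV.IsCut ends z VA VB EA EB) {a₁ : V}
    (ha₁ : a₁ ∈ VA ∪ {z}) {𝓔 : Set (Set V)} (hside : ∀ S : Set V, S ∈ 𝓔 ↔ S ∩ (VA ∪ {z}) ∈ 𝓔) :
    DependsOn (· ∈ clusterInEvent ends a₁ 𝓔) EA := by
  have key : clusterInEvent ends a₁ 𝓔 = CutV.sideEvent EA (clusterInEvent ends a₁ 𝓔) := by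
    ext ω
    simp only [CutV.mem_sideEvent, mem_clusterInEvent]
    rw [hside (cluster ends ω a₁), CutV.cluster_inter_eq h ha₁]
  rw [key]
  exact CutV.dependsOn_sideEvent EA _

omit [Fintype E] [DecidableEq E] in
/-- Intersections of events determined by `F` are determined by `F`. -/
lemma dependsOn_inter' {F : Set E} {A B : Set (Config E)} (hA : DependsOn (· ∈ A) F)
    (hB : DependsOn (· ∈ B) F) : DependsOn (· ∈ A ∩ B) F := by
  simpa using dependsOn_inter hA hB

omit [Fintype E] [DecidableEq E] in
/-- Unions of events determined by `F` are determined by `F`. -/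
lemma dependsOn_union' {F : Set E} {A B : Set (Config E)} (hA : DependsOn (· ∈ A) F)
    (hB : DependsOn (· ∈ B) F) : DependsOn (· ∈ A ∪ B) F := by
  simpa using dependsOn_union hA hB

omit [LinearOrder R] [IsStrictOrderedRing R] [DecidablePred (· ∈ EA)] in
/-- A near-side event and a far-side event are independent. -/
lemma prob_inter_far (p : E → R) (h : CutV.IsCut ends z VA VB EA EB) {X : Set (Config E)}
    (hX : DependsOn (· ∈ X) EA) (Y : Set (Config E)) :
    prob p (X ∩ CutV.sideEvent EB Y) = prob p X * prob p (CutV.sideEvent EB Y) :=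
  prob_inter_eq_mul_of_dependsOn p h.Edisj hX (CutV.dependsOn_sideEvent EB Y)

/-- **The `o`-side transfer of row 2′CD.** If `z` is a cut vertex separating `o` from `a₁, a₂, a₃` and
`𝓔` reads only the near side, then row 2′CD for the mark `z` implies row 2′CD for the mark `o`
(same roots, same `a₃`, same `𝓔`, same weight vector). -/
theorem cd_of_cut_o (p : E → R) (hp : IsProbVec p) (h : CutV.IsCut ends z VA VB EA EB)
    {a₁ a₂ a₃ o : V} (ha₁ : a₁ ∈ VA ∪ {z}) (ha₂ : a₂ ∈ VA ∪ {z}) (ha₃ : a₃ ∈ VA ∪ {z})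
    (ho : o ∈ VB) {𝓔 : Set (Set V)} (hside : ∀ S : Set V, S ∈ 𝓔 ↔ S ∩ (VA ∪ {z}) ∈ 𝓔)
    (hz :
      let Q := (connEvent ends a₁ a₂)ᶜ
      let U := clusterInEvent ends a₁ 𝓔
      let e := connEvent ends a₁ a₃
      let f := connEvent ends a₂ z
      let N := (connEvent ends a₁ a₃)ᶜ ∩ (connEvent ends a₂ a₃)ᶜ
      let oU := connEvent ends a₁ z ∪ connEvent ends a₂ z
      prob p (Q ∩ N) * (prob p Q * prob p (Q ∩ U ∩ e ∩ f) - prob p (Q ∩ U) * prob p (Q ∩ e ∩ f)) ≤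
        prob p (Q ∩ N ∩ oU) * (prob p Q * prob p (Q ∩ U ∩ e) - prob p (Q ∩ U) * prob p (Q ∩ e))) :
    let Q := (connEvent ends a₁ a₂)ᶜ
    let U := clusterInEvent ends a₁ 𝓔
    let e := connEvent ends a₁ a₃
    let f := connEvent ends a₂ o
    let N := (connEvent ends a₁ a₃)ᶜ ∩ (connEvent ends a₂ a₃)ᶜ
    let oU := connEvent ends a₁ o ∪ connEvent ends a₂ o
    prob p (Q ∩ N) * (prob p Q * prob p (Q ∩ U ∩ e ∩ f) - prob p (Q ∩ U) * prob p (Q ∩ e ∩ f)) ≤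
      prob p (Q ∩ N ∩ oU) * (prob p Q * prob p (Q ∩ U ∩ e) - prob p (Q ∩ U) * prob p (Q ∩ e)) := by
  intro Q U e f N oU
  simp only at hz
  -- the far-side factor
  set H := CutV.sideEvent EB (connEvent ends z o) with hH
  have hf : f = connEvent ends a₂ z ∩ H := connEvent_o_eq h ha₂ ho
  have hoU : oU = (connEvent ends a₁ z ∪ connEvent ends a₂ z) ∩ H := by
    show connEvent ends a₁ o ∪ connEvent ends a₂ o = _
    rw [connEvent_o_eq h ha₁ ho, connEvent_o_eq h ha₂ ho, Set.union_inter_distrib_right]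
  -- the near-side events
  have dQ : DependsOn (· ∈ Q) EA := dependsOn_compl (dependsOn_connEvent_near h ha₁ ha₂)
  have dU : DependsOn (· ∈ U) EA := dependsOn_clusterInEvent_near h ha₁ hside
  have de : DependsOn (· ∈ e) EA := dependsOn_connEvent_near h ha₁ ha₃
  have dfz : DependsOn (· ∈ connEvent ends a₂ z) EA := dependsOn_connEvent_near h ha₂ (Or.inr rfl)
  have dN : DependsOn (· ∈ N) EA :=
    dependsOn_inter' (dependsOn_compl (dependsOn_connEvent_near h ha₁ ha₃))
      (dependsOn_compl (dependsOn_connEvent_near h ha₂ ha₃))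
  have doUz : DependsOn (· ∈ connEvent ends a₁ z ∪ connEvent ends a₂ z) EA :=
    dependsOn_union' (dependsOn_connEvent_near h ha₁ (Or.inr rfl)) dfz
  -- the three `o`-probabilities factorise
  have e1 : prob p (Q ∩ U ∩ e ∩ f) = prob p (Q ∩ U ∩ e ∩ connEvent ends a₂ z) * prob p H := by
    rw [hf, ← Set.inter_assoc]
    exact prob_inter_far p h (dependsOn_inter' (dependsOn_inter' (dependsOn_inter' dQ dU) de) dfz) _
  have e2 : prob p (Q ∩ e ∩ f) = prob p (Q ∩ e ∩ connEvent ends a₂ z) * prob p H := by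
    rw [hf, ← Set.inter_assoc]
    exact prob_inter_far p h (dependsOn_inter' (dependsOn_inter' dQ de) dfz) _
  have e3 : prob p (Q ∩ N ∩ oU) =
      prob p (Q ∩ N ∩ (connEvent ends a₁ z ∪ connEvent ends a₂ z)) * prob p H := by
    rw [hoU, ← Set.inter_assoc]
    exact prob_inter_far p h (dependsOn_inter' (dependsOn_inter' dQ dN) doUz) _
  have hρ : 0 ≤ prob p H := prob_nonneg hp _
  rw [e1, e2, e3]
  calc prob p (Q ∩ N) * (prob p Q * (prob p (Q ∩ U ∩ e ∩ connEvent ends a₂ z) * prob p H) -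
        prob p (Q ∩ U) * (prob p (Q ∩ e ∩ connEvent ends a₂ z) * prob p H))
      = (prob p (Q ∩ N) * (prob p Q * prob p (Q ∩ U ∩ e ∩ connEvent ends a₂ z) -
          prob p (Q ∩ U) * prob p (Q ∩ e ∩ connEvent ends a₂ z))) * prob p H := by ring
    _ ≤ (prob p (Q ∩ N ∩ (connEvent ends a₁ z ∪ connEvent ends a₂ z)) *
          (prob p Q * prob p (Q ∩ U ∩ e) - prob p (Q ∩ U) * prob p (Q ∩ e))) * prob p H :=
        mul_le_mul_of_nonneg_right hz hρ
    _ = prob p (Q ∩ N ∩ (connEvent ends a₁ z ∪ connEvent ends a₂ z)) * prob p H *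
          (prob p Q * prob p (Q ∩ U ∩ e) - prob p (Q ∩ U) * prob p (Q ∩ e)) := by ring

omit [IsStrictOrderedRing R] in
/-- **Row 2′CD for the mark `z = a₂` itself** is an equality: `{o ∈ C₂}` with `o = a₂` is the sure event. -/
theorem cd_at_a₂ (p : E → R) (ends : E → Sym2 V) (a₁ a₂ a₃ : V) (𝓔 : Set (Set V)) :
    let Q := (connEvent ends a₁ a₂)ᶜ
    let U := clusterInEvent ends a₁ 𝓔
    let e := connEvent ends a₁ a₃
    let f := connEvent ends a₂ a₂
    let N := (connEvent ends a₁ a₃)ᶜ ∩ (connEvent ends a₂ a₃)ᶜ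
    let oU := connEvent ends a₁ a₂ ∪ connEvent ends a₂ a₂
    prob p (Q ∩ N) * (prob p Q * prob p (Q ∩ U ∩ e ∩ f) - prob p (Q ∩ U) * prob p (Q ∩ e ∩ f)) ≤
      prob p (Q ∩ N ∩ oU) * (prob p Q * prob p (Q ∩ U ∩ e) - prob p (Q ∩ U) * prob p (Q ∩ e)) := by
  intro Q U e f N oU
  have hf : f = Set.univ := by
    ext ω; simp only [f, mem_connEvent, Set.mem_univ, iff_true]; exact conn_refl _ _ _
  have hoU : oU = Set.univ := by
    ext ω
    simp only [oU, Set.mem_union, mem_connEvent, Set.mem_univ, iff_true]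
    exact Or.inr (conn_refl _ _ _)
  simp only [hf, hoU, Set.inter_univ, le_refl]

/-- **Row 2′CD for the mark `z = a₁` itself**: `{o ∈ C₂}` with `o = a₁` is empty under `Q`, and the
right-hand side is the PA boost (BHK06 Thm 1.3, `CDRequired.pa_upset_e`). -/
theorem cd_at_a₁ [Fintype V] [DecidableEq V] (p : E → R) (hp : IsProbVec p) (ends : E → Sym2 V)
    (a₁ a₂ a₃ : V) {𝓔 : Set (Set V)} (h𝓔 : IsUpperSet 𝓔) :
    let Q := (connEvent ends a₁ a₂)ᶜ
    let U := clusterInEvent ends a₁ 𝓔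
    let e := connEvent ends a₁ a₃
    let f := connEvent ends a₂ a₁
    let N := (connEvent ends a₁ a₃)ᶜ ∩ (connEvent ends a₂ a₃)ᶜ
    let oU := connEvent ends a₁ a₁ ∪ connEvent ends a₂ a₁
    prob p (Q ∩ N) * (prob p Q * prob p (Q ∩ U ∩ e ∩ f) - prob p (Q ∩ U) * prob p (Q ∩ e ∩ f)) ≤
      prob p (Q ∩ N ∩ oU) * (prob p Q * prob p (Q ∩ U ∩ e) - prob p (Q ∩ U) * prob p (Q ∩ e)) := by
  intro Q U e f N oU
  have hQf : Q ∩ f = ∅ := by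
    ext ω
    simp only [Q, f, Set.mem_inter_iff, Set.mem_compl_iff, mem_connEvent, Set.mem_empty_iff_false,
      iff_false, not_and]
    exact fun h1 h2 => absurd (conn_symm h2) h1
  have h1 : Q ∩ U ∩ e ∩ f = ∅ := by
    have hsub : Q ∩ U ∩ e ∩ f ⊆ Q ∩ f := fun ω hω => ⟨hω.1.1.1, hω.2⟩
    rw [hQf] at hsub
    exact Set.subset_empty_iff.mp hsub
  have h2 : Q ∩ e ∩ f = ∅ := by
    have hsub : Q ∩ e ∩ f ⊆ Q ∩ f := fun ω hω => ⟨hω.1.1, hω.2⟩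
    rw [hQf] at hsub
    exact Set.subset_empty_iff.mp hsub
  have hoU : oU = Set.univ := by
    ext ω
    simp only [oU, Set.mem_union, mem_connEvent, Set.mem_univ, iff_true]
    exact Or.inl (conn_refl _ _ _)
  have hPA := CDRequired.pa_upset_e p hp ends a₁ a₂ a₃ h𝓔
  simp only at hPA
  rw [h1, h2, hoU, Set.inter_univ, prob_empty p]
  have hn : 0 ≤ prob p (Q ∩ N) := prob_nonneg hp _
  have hb : 0 ≤ prob p Q * prob p (Q ∩ U ∩ e) - prob p (Q ∩ U) * prob p (Q ∩ e) := by
    linarith [hPA]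
  nlinarith [mul_nonneg hn hb]

/-- **Row 2′CD when `o` lies beyond the root `a₂`**: `a₂` a cut vertex separating `o` from `a₁, a₃`,
`𝓔` reading only the near side — every up-set, every weight vector. -/
theorem cd_of_o_beyond_a₂ (p : E → R) (hp : IsProbVec p) (h : CutV.IsCut ends z VA VB EA EB)
    {a₁ a₃ o : V} (ha₁ : a₁ ∈ VA ∪ {z}) (ha₃ : a₃ ∈ VA ∪ {z}) (ho : o ∈ VB) {𝓔 : Set (Set V)}
    (hside : ∀ S : Set V, S ∈ 𝓔 ↔ S ∩ (VA ∪ {z}) ∈ 𝓔) :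
    let Q := (connEvent ends a₁ z)ᶜ
    let U := clusterInEvent ends a₁ 𝓔
    let e := connEvent ends a₁ a₃
    let f := connEvent ends z o
    let N := (connEvent ends a₁ a₃)ᶜ ∩ (connEvent ends z a₃)ᶜ
    let oU := connEvent ends a₁ o ∪ connEvent ends z o
    prob p (Q ∩ N) * (prob p Q * prob p (Q ∩ U ∩ e ∩ f) - prob p (Q ∩ U) * prob p (Q ∩ e ∩ f)) ≤
      prob p (Q ∩ N ∩ oU) * (prob p Q * prob p (Q ∩ U ∩ e) - prob p (Q ∩ U) * prob p (Q ∩ e)) :=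
  cd_of_cut_o p hp h ha₁ (Or.inr rfl) ha₃ ho hside (cd_at_a₂ p ends a₁ z a₃ 𝓔)

/-- **Row 2′CD when `o` lies beyond the root `a₁`**: `a₁` a cut vertex separating `o` from `a₂, a₃`,
`𝓔` reading only the near side — every up-set, every weight vector. -/
theorem cd_of_o_beyond_a₁ [Fintype V] [DecidableEq V] (p : E → R) (hp : IsProbVec p)
    (h : CutV.IsCut ends z VA VB EA EB)
    {a₂ a₃ o : V} (ha₂ : a₂ ∈ VA ∪ {z}) (ha₃ : a₃ ∈ VA ∪ {z}) (ho : o ∈ VB) {𝓔 : Set (Set V)}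
    (h𝓔 : IsUpperSet 𝓔) (hside : ∀ S : Set V, S ∈ 𝓔 ↔ S ∩ (VA ∪ {z}) ∈ 𝓔) :
    let Q := (connEvent ends z a₂)ᶜ
    let U := clusterInEvent ends z 𝓔
    let e := connEvent ends z a₃
    let f := connEvent ends a₂ o
    let N := (connEvent ends z a₃)ᶜ ∩ (connEvent ends a₂ a₃)ᶜ
    let oU := connEvent ends z o ∪ connEvent ends a₂ o
    prob p (Q ∩ N) * (prob p Q * prob p (Q ∩ U ∩ e ∩ f) - prob p (Q ∩ U) * prob p (Q ∩ e ∩ f)) ≤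
      prob p (Q ∩ N ∩ oU) * (prob p Q * prob p (Q ∩ U ∩ e) - prob p (Q ∩ U) * prob p (Q ∩ e)) :=
  cd_of_cut_o p hp h (Or.inr rfl) ha₂ ha₃ ho hside (cd_at_a₁ p hp ends z a₂ a₃ h𝓔)

/-- **Row 2′CD is trivial when `{a₁ ↔ a₃}` and `{a₂ ↔ o}` cannot both hold under `Q`**: then the
left-hand side vanishes and the right-hand side is the PA boost. -/
theorem cd_of_ef_empty [Fintype V] [DecidableEq V] (p : E → R) (hp : IsProbVec p) (ends : E → Sym2 V)
    (a₁ a₂ a₃ o : V) {𝓔 : Set (Set V)} (h𝓔 : IsUpperSet 𝓔)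
    (hef : (connEvent ends a₁ a₂)ᶜ ∩ connEvent ends a₁ a₃ ∩ connEvent ends a₂ o = ∅) :
    let Q := (connEvent ends a₁ a₂)ᶜ
    let U := clusterInEvent ends a₁ 𝓔
    let e := connEvent ends a₁ a₃
    let f := connEvent ends a₂ o
    let N := (connEvent ends a₁ a₃)ᶜ ∩ (connEvent ends a₂ a₃)ᶜ
    let oU := connEvent ends a₁ o ∪ connEvent ends a₂ o
    prob p (Q ∩ N) * (prob p Q * prob p (Q ∩ U ∩ e ∩ f) - prob p (Q ∩ U) * prob p (Q ∩ e ∩ f)) ≤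
      prob p (Q ∩ N ∩ oU) * (prob p Q * prob p (Q ∩ U ∩ e) - prob p (Q ∩ U) * prob p (Q ∩ e)) := by
  intro Q U e f N oU
  have h1 : Q ∩ U ∩ e ∩ f = ∅ := by
    have hsub : Q ∩ U ∩ e ∩ f ⊆ Q ∩ e ∩ f := fun ω hω => ⟨⟨hω.1.1.1, hω.1.2⟩, hω.2⟩
    rw [hef] at hsub
    exact Set.subset_empty_iff.mp hsub
  have hPA := CDRequired.pa_upset_e p hp ends a₁ a₂ a₃ h𝓔
  simp only at hPA
  rw [h1, hef, prob_empty p]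
  have hn : 0 ≤ prob p (Q ∩ N ∩ oU) := prob_nonneg hp _
  have hb : 0 ≤ prob p Q * prob p (Q ∩ U ∩ e) - prob p (Q ∩ U) * prob p (Q ∩ e) := by
    linarith [hPA]
  nlinarith [mul_nonneg hn hb]

/-- **Row 2′CD when `a₃` and `o` lie beyond the same cut vertex `z`** (the roots on the other side):
every `a₁–a₃` path and every `a₂–o` path pass through `z`, so `{a₁ ↔ a₃} ∩ {a₂ ↔ o}` forces
`a₁ ↔ a₂` — the row is trivial, for every family `𝓔` and every weight vector. -/
theorem cd_of_a₃_o_beyond [Fintype V] [DecidableEq V] (p : E → R) (hp : IsProbVec p)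
    (h : CutV.IsCut ends z VA VB EA EB) {a₁ a₂ a₃ o : V} (ha₁ : a₁ ∈ VA ∪ {z}) (ha₂ : a₂ ∈ VA ∪ {z})
    (ha₃ : a₃ ∈ VB) (ho : o ∈ VB) {𝓔 : Set (Set V)} (h𝓔 : IsUpperSet 𝓔) :
    let Q := (connEvent ends a₁ a₂)ᶜ
    let U := clusterInEvent ends a₁ 𝓔
    let e := connEvent ends a₁ a₃
    let f := connEvent ends a₂ o
    let N := (connEvent ends a₁ a₃)ᶜ ∩ (connEvent ends a₂ a₃)ᶜ
    let oU := connEvent ends a₁ o ∪ connEvent ends a₂ o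
    prob p (Q ∩ N) * (prob p Q * prob p (Q ∩ U ∩ e ∩ f) - prob p (Q ∩ U) * prob p (Q ∩ e ∩ f)) ≤
      prob p (Q ∩ N ∩ oU) * (prob p Q * prob p (Q ∩ U ∩ e) - prob p (Q ∩ U) * prob p (Q ∩ e)) := by
  refine cd_of_ef_empty p hp ends a₁ a₂ a₃ o h𝓔 ?_
  ext ω
  refine ⟨fun hω => ?_, fun hω => hω.elim⟩
  obtain ⟨⟨hQ, h13⟩, h2o⟩ := hω
  rw [mem_connEvent] at h13 h2o
  apply hQ
  show Conn ends ω a₁ a₂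
  have h1z : Conn ends ω a₁ z :=
    conn_mono (restrict_le EA ω)
      ((CDCutVertex.conn_iff_across_or_cut h ha₁ (Or.inl ha₃)).mp h13).1
  have h2z : Conn ends ω a₂ z :=
    conn_mono (restrict_le EA ω)
      ((CDCutVertex.conn_iff_across_or_cut h ha₂ (Or.inl ho)).mp h2o).1
  exact conn_trans h1z (conn_symm h2z)

end Main

end CDCutO

end Summit.Ventures.PercRepro2
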